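import Summits.MatrixMultiplication.OmegaCensus.STPPVosperSlackOneBetaCover

/-!
# ω-census (abelian STPP census): the exact-cover stage in case β of the slack-1 laws (kernel, UNCONDITIONAL)

HONEST FRAMING (pub-omega census; verbatim): lottery ticket; floor = certified bounds/negative ranges.
Census STRUCTURE (seat pub-omega-stpp-1 gen 31, 2026-08-28), family (b2).  The contradiction step shared by the β-cover laws: given the case-β data of a
slack-1 block (`Bᵢ = {β₁ + k e′ : k ≤ b, k ≠ g₁}`, `V ⊆` the `e′`-window of `n + 1` slots with `|V| = n` and hole `v + hh e′ ∉ V`, `Bᵢ + V = H ∖ Z°`,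
`Y° = {y₀ + t d : t < L}`), the other blocks exactly cover the value lists `[(e′⁻¹ d) t : t < L]` and `ZLof p n b hh g₀`, so
`existsCoverZ … = true` (`existsCoverZ_true_of_isSTPP`); a `decide`d `false` is a contradiction (`false_of_caseB_cover`).  Nothing here is progress on `ω`.
-/

open Finset
open scoped Pointwise

namespace Summit.MatrixMultiplication.OmegaCensus.CubeNB

open Literature.Computability.AlgebraicComplexity
open Literature.Combinatorics.Additive
open Summit.MatrixMultiplication.OmegaCensus.STPPKneser

variable {p : ℕ} [hp : Fact p.Prime] {N : ℕ} {A B C : Fin N → Finset (ZMod p)}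

/-- **The exact-cover stage in case β** (see the module docstring). [cite: CohnKleinbergSzegedyUmans2005, Def. 5.1] -/
theorem false_of_caseB_cover (hS : IsSTPP A B C) (hA : ∀ k, (A k).Nonempty) (hB : ∀ k, (B k).Nonempty) (hC : ∀ k, (C k).Nonempty)
    (i : Fin N) (ks : List (Fin N)) (hks : ks.Nodup) (hksi : ∀ k, k ∈ ks ↔ k ≠ i)
    {e' β₁ v d y₀ : ZMod p} {b g₁ g₀ n hh L : ℕ} (he' : e' ≠ 0) (hd : d ≠ 0)
    (hBE₁ : B i = apErase β₁ e' (b + 1) g₁) (hgg : b - g₁ = g₀ + 1) (hg₁ : g₁ < b)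
    {V : Finset (ZMod p)} (hVsub : V ⊆ apFinset v e' (n + 1)) (hVn : #V = n) (hhh : hh < n + 1) (hhole : v + hh • e' ∉ V)
    (hnb : n + 1 + b ≤ p) (hEq : B i + V = univ \ DU A C (univ.erase i))
    (hy : DU B C (univ.erase i) = apFinset y₀ d L) (hLp : L < p)
    (hcover : existsCoverZ p ((List.range L).map fun k => ((e'⁻¹ * d).val * k) % p) (ZLof p n b hh g₀)
      (ks.map fun k => (#(A k), #(B k), #(C k))) [] [] = false) : False := by
  set Yo := DU B C (univ.erase i) with hYo
  set Zo := DU A C (univ.erase i) with hZo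
  set u : ZMod p := e'⁻¹ with hu
  have hu0 : u ≠ 0 := inv_ne_zero he'
  have hue : u * e' = 1 := inv_mul_cancel₀ he'
  have heu : e' * u = 1 := mul_inv_cancel₀ he'
  have hg₁' : g₁ = b - 1 - g₀ := by omega
  -- `V = window ∖ {hole}`
  have hn1 : n + 1 ≤ p := by omega
  have hVeq : ∀ y : ℕ, y ≤ n → y ≠ hh → v + y • e' ∈ V := by
    intro y hy hyh
    by_contra hnot
    have hsub2 : insert (v + y • e') (insert (v + hh • e') (V)) ⊆ apFinset v e' (n + 1) := by
      refine Finset.insert_subset (mem_apFinset.2 ⟨y, by omega, rfl⟩) (Finset.insert_subset (mem_apFinset.2 ⟨hh, hhh, rfl⟩) hVsub)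
    have hne : v + y • e' ≠ v + hh • e' := fun h =>
      hyh (HamidouneRodseth.nat_eq_of_nsmul_eq he' (by omega) (by omega) (add_left_cancel h))
    have hcard := Finset.card_le_card hsub2
    rw [Finset.card_insert_of_notMem (by rw [Finset.mem_insert, not_or]; exact ⟨hne, hnot⟩), Finset.card_insert_of_notMem hhole, hVn,
      card_apFinset he' hn1] at hcard
    omega
  -- `Y°` values
  have hvalYt : ∀ t : ℕ, (u * (y₀ + t • d - y₀)).val = ((u * d).val * t) % p := by
    intro t
    have : u * (y₀ + t • d - y₀) = 0 + t • (u * d) := by rw [nsmul_eq_mul, nsmul_eq_mul]; ring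
    rw [this, val_add_nsmul_zmod, ZMod.val_zero, zero_add]
  have hj0 : u * d ≠ 0 := mul_ne_zero hu0 hd
  have hLp : L < p := by omega
  have hYLnd : ((List.range L).map fun t => ((u * d).val * t) % p).Nodup := by
    refine List.Nodup.map_on ?_ List.nodup_range
    intro t ht t' ht' h
    rw [List.mem_range] at ht ht'
    refine zmod_natMul_injOn (t := (0 : ZMod p)) hj0 (by omega) (by omega) ?_
    apply ZMod.val_injective p
    rw [val_add_nsmul_zmod, val_add_nsmul_zmod, ZMod.val_zero, zero_add, zero_add]
    exact h
  have hYin : ∀ x ∈ Yo, (u * (x - y₀)).val ∈ (List.range L).map fun t => ((u * d).val * t) % p := by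
    intro x hx
    rw [hy] at hx
    obtain ⟨t, ht, rfl⟩ := mem_apFinset.1 hx
    exact List.mem_map.2 ⟨t, List.mem_range.2 ht, (hvalYt t).symm⟩
  have hYsurj : ∀ yv ∈ (List.range L).map (fun t => ((u * d).val * t) % p), ∃ x ∈ Yo, (u * (x - y₀)).val = yv := by
    intro yv hyv
    obtain ⟨t, ht, rfl⟩ := List.mem_map.1 hyv
    rw [List.mem_range] at ht
    exact ⟨y₀ + t • d, by rw [hy]; exact mem_apFinset.2 ⟨t, ht, rfl⟩, hvalYt t⟩
  -- `Z°` values relative to `z₀ = β₁ + v`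
  have hZoEq : Zo = univ \ (B i + (V)) := by
    rw [hEq, sdiff_sdiff_right_self, Finset.inf_eq_inter, Finset.univ_inter]
  have hvalZt : ∀ t : ℕ, t < p → (u * (β₁ + v + t • e' - (β₁ + v))).val = t := by
    intro t ht
    have : u * (β₁ + v + t • e' - (β₁ + v)) = (t : ZMod p) := by rw [nsmul_eq_mul]; linear_combination (t : ZMod p) * hue
    rw [this, ZMod.val_natCast, Nat.mod_eq_of_lt ht]
  have hsumrep : ∀ x' y : ℕ, (β₁ + x' • e') + (v + y • e') = β₁ + v + (x' + y) • e' := by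
    intro x' y; rw [add_nsmul]; abel
  have hZin : ∀ x ∈ Zo, (u * (x - (β₁ + v))).val ∈ ZLof p n b hh g₀ := by
    intro x hx
    rw [mem_ZLof]
    refine ⟨ZMod.val_lt _, fun x' hx' hx'g y hy hyh hsum => ?_⟩
    have hxeq : x = (β₁ + x' • e') + (v + y • e') := by
      rw [hsumrep, hsum]
      have h1 : ((u * (x - (β₁ + v))).val : ZMod p) = u * (x - (β₁ + v)) := ZMod.natCast_zmod_val _
      rw [nsmul_eq_mul, h1]
      linear_combination (-(x - (β₁ + v))) * heu
    have hmem : x ∈ B i + (V) := by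
      rw [hxeq]
      exact Finset.add_mem_add (by rw [hBE₁]; exact mem_apErase.2 ⟨x', by omega, by rw [hg₁'] at *; exact hx'g, rfl⟩) (hVeq y hy hyh)
    rw [hZoEq, Finset.mem_sdiff] at hx
    exact hx.2 hmem
  have hZsurj : ∀ t ∈ ZLof p n b hh g₀, ∃ x ∈ Zo, (u * (x - (β₁ + v))).val = t := by
    intro t ht
    rw [mem_ZLof] at ht
    obtain ⟨htp, hns⟩ := ht
    refine ⟨β₁ + v + t • e', ?_, hvalZt t htp⟩
    rw [hZoEq, Finset.mem_sdiff]
    refine ⟨Finset.mem_univ _, fun hmem => ?_⟩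
    obtain ⟨bb, hbb, vv, hvv, hbv⟩ := Finset.mem_add.1 hmem
    rw [hBE₁] at hbb
    obtain ⟨x', hx', hx'g, rfl⟩ := mem_apErase.1 hbb
    have hvvW := hVsub hvv
    obtain ⟨y, hy, rfl⟩ := mem_apFinset.1 hvvW
    have hyh : y ≠ hh := by rintro rfl; exact hhole hvv
    rw [hsumrep] at hbv
    have := HamidouneRodseth.nat_eq_of_nsmul_eq he' (by omega) htp (add_left_cancel hbv)
    exact hns x' (by omega) (by rw [hg₁'] at hx'g; exact hx'g) y (by omega) hyh this
  have htrue := existsCoverZ_true_of_isSTPP hS hA hB hC i ks hks hksi hu0 hYLnd hYin hYsurj hZin hZsurj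
  have hcover' := hcover
  simp only [hu] at htrue
  rw [htrue] at hcover'
  exact Bool.noConfusion hcover'

end Summit.MatrixMultiplication.OmegaCensus.CubeNB
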